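import Summits.CriticalPhenomena.PercolationContinuityZ3.Theorems.Transplant.SkelPhiConcScheduleN
import HarnessLib

/-!
# N2 (frames-only node `SamePDropOfSkeletonFrm₁`, OPEN), (C) column: THE TWO STUB-PROFILE ROWS OF THE SCHEDULE OF RECORD —
# `Skelφ.concRadii2N_le_ρ` (`X + 2 ≤ E₀ ⟹ X ≤ ρ a v δ ℓ`) and `Skelφ.concRadii2N_ρ_succ_le_rM` (`1 ≤ a`, `gap' = 0`, `L′ ≤ gap _` ⟹ `ρ a v δ ℓ + 1 ≤ rM a (v + δ)`),
# served at `Skelφ.Prm.schedN S P off` as `Prm.schedN_le_ρ` / `Prm.schedN_ρ_succ_le_rM`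

The (C) residue's radius rows `hDρ' : R + 1 ≤ Λ.ρ a' y du l` and `hρM : Λ.ρ a' y du l + 1 ≤ Λ.rM a' (y + stepVec du)` (SkelPhiCorridorKGRoomsQ, read by
hp-8 g40's `mem_habΩS_of_footprint` / `mem_Mb_of_mem_habΩS`) at the schedule of record `Λ := schedOfS … S = Prm.schedN S fcellsA offNS`:
* the profile is a `min` of recursion radii `E(·)`, `F(·)` minus two, all `≥ E₀`, so `ρ ≥ E₀ − 2`;
* for a stub anchor `a ≥ 1` the own-cube level is `nS a v = a + 1` and the target-cube level is `nQ a (v + δ) = a + 2` (BoxProdZ2ConcScheduleG), so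
  `rM a (v + δ) = F(a + 2) − L′ = E(a + 1) + gap (E(a+1)) − L′ ≥ E(a + 1) ≥ ρ + 2` as soon as `L′ ≤ gap _` (`Prm.hgapL`) and `gap' = 0` (as in `Prm.schedN`).
The root anchor `a = 0` (planar generation `gen0`) is NOT covered here (it needs `gen0 (v + δ) ≥ nS 0 v + 1` at the probe; scheme-geometry side, hp-8 g40).
builds on p205010 (kernel theorem, internal audit signed; external expert review pending) — nothing in this file uses p205010; nothing here is a claim
about the open node `SamePDropOfSkeletonFrm₁`.
Lane `prim-bschramm`, seat `prim-bschramm-p5` (gen 16; (C) lineage); helper file (`--supports stmt-CriticalPhenomena-4575 --as helper`).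
[cite: KozmaNitzan2024, §4 pp. 25–27, 30–31 (Q_v, M_v, H^j_{v,x}: the windows grow with the level)]
-/

noncomputable section

open scoped Classical

namespace Summit.CriticalPhenomena.PercolationContinuityZ3.Theorems

namespace Transplant

namespace Skelφ

open Literature.Probability.Percolation Literature.Probability.LatticeModels SimpleGraph
open BoxProdZ2 (ConcRadiiG Erad Frad nQ nS Erad_mono Frad_mono Frad_le_Erad)
open Skel (E₀_le_Erad E₀_le_Frad)

section Sched

variable (P : PCells2) (gap gap' : ℕ → ℕ) (E₀ L' : ℕ) (off : Site 2 → ℕ)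

/-- **The product profile is at least `E₀`**: every radius in its `min` is a recursion radius `E(·)` or `F(·)`. [folklore] -/
theorem E₀_le_ρ2 (a : ℕ) (v : Site 2) (δ : MDir) (ℓ : ℤ) : E₀ ≤ (concRadii2Of P gap gap' E₀ L').ρ a v δ ℓ := by
  have hE := E₀_le_Erad gap gap' E₀
  have hF := E₀_le_Frad gap gap' E₀
  change E₀ ≤ (if ℓ ≤ 5 * (P.r δ.1 : ℤ) then _ else _)
  split_ifs
  · exact le_min (le_min (hE _) (le_min (hF _) (hE _))) (le_min (hE _) (hE _))
  · exact le_min (hE _) (le_min (hF _) (hE _))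

/-- **LOWER STUB-PROFILE ROW**: `X + 2 ≤ E₀ ⟹ X ≤ ρ a v δ ℓ` for the schedule with the column slot. [folklore] -/
theorem concRadii2N_le_ρ {X : ℕ} (hX : X + 2 ≤ E₀) (a : ℕ) (v : Site 2) (δ : MDir) (ℓ : ℤ) : X ≤ (concRadii2N P gap gap' E₀ L' off).ρ a v δ ℓ := by
  rw [concRadii2N_ρ]
  have := E₀_le_ρ2 P gap gap' E₀ L' a v δ ℓ
  omega

/-- **THE DEPTH ROOM OF THE ARRIVAL CUBE**: for a stub anchor `a ≥ 1`, with `gap' = 0`, `1 ≤ E₀` and `L′ ≤ gap r` for every `r`, the profile plus one fits the target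
cube's `M`-window radius: `ρ a v δ ℓ + 1 ≤ rM a (v + stepVec δ)`. [cite: KozmaNitzan2024, §4 pp. 26–27 (M_v inside the growing windows)] -/
theorem concRadii2N_ρ_succ_le_rM (hE₀ : 1 ≤ E₀) (hL : ∀ r, L' ≤ gap r) {a : ℕ} (ha : 1 ≤ a) (v : Site 2) (δ : MDir) (ℓ : ℤ) :
    (concRadii2N P gap (fun _ => 0) E₀ L' off).ρ a v δ ℓ + 1 ≤ (concRadii2N P gap (fun _ => 0) E₀ L' off).rM a (v + stepVec δ) := by
  rw [concRadii2N_ρ, concRadii2N_rM]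
  have ha0 : a ≠ 0 := by omega
  have hnQ : nQ a (v + stepVec δ) = a + 2 := by unfold nQ; rw [if_neg ha0]
  have hnS : nS a v = a + 1 := by unfold nS; rw [if_neg ha0]
  have hρ : (concRadii2Of P gap (fun _ => 0) E₀ L').ρ a v δ ℓ ≤ Erad gap (fun _ => 0) E₀ (a + 1) := by rw [← hnS]; exact ρ2_le P gap _ E₀ L' a v δ ℓ
  have hF : Frad gap (fun _ => 0) E₀ (a + 2) = Erad gap (fun _ => 0) E₀ (a + 1) + gap (Erad gap (fun _ => 0) E₀ (a + 1)) := BoxProdZ2.Frad_succ gap _ E₀ (a + 1)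
  have hLg := hL (Erad gap (fun _ => 0) E₀ (a + 1))
  have hE1 := E₀_le_Erad gap (fun _ => 0) E₀ (a + 1)
  rw [hnQ, hF]
  omega

end Sched

namespace Prm

/-- **`X + 2 ≤ E₀ S ⟹ X ≤ (schedN S P off).ρ a v δ ℓ`** (the (C) row `hDρ'` at `X := R + 1`, i.e. `R + 3 ≤ E₀ S`). [folklore] -/
theorem schedN_le_ρ (S : SchedIn) (P : PCells2) (off : Site 2 → ℕ) {X : ℕ} (hX : X + 2 ≤ E₀ S) (a : ℕ) (v : Site 2) (δ : MDir) (ℓ : ℤ) :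
    X ≤ (schedN S P off).ρ a v δ ℓ :=
  concRadii2N_le_ρ P _ _ _ _ off hX a v δ ℓ

/-- **`(schedN S P off).ρ a v δ ℓ + 1 ≤ (schedN S P off).rM a (v + stepVec δ)` for every stub anchor `a ≥ 1`** (the (C) row `hρM` away from the root
anchor; `Lp S ≤ gap S r` is `Prm.hgapL`). [cite: KozmaNitzan2024, §4 pp. 26–27] -/
theorem schedN_ρ_succ_le_rM (S : SchedIn) (P : PCells2) (off : Site 2 → ℕ) {a : ℕ} (ha : 1 ≤ a) (v : Site 2) (δ : MDir) (ℓ : ℤ) :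
    (schedN S P off).ρ a v δ ℓ + 1 ≤ (schedN S P off).rM a (v + stepVec δ) :=
  concRadii2N_ρ_succ_le_rM P _ _ _ off (le_trans (by norm_num) (two_le_E₀ S)) (hgapL S) ha v δ ℓ

end Prm

end Skelφ

end Transplant

end Summit.CriticalPhenomena.PercolationContinuityZ3.Theorems

end
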